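/-
Copyright (c) 2026 the pub-hodgecm-mathlib formalisation cell (harness21).  Prover seat hodgecm-mathlib-K2Liu-p01 (g5), Track B «K2-LIT»,
Road I §G2 organ W4a «bridge (D-pin)» (LEAD F0P6-plan (g12) 07:09:36Z; K2E5-plan (g5) 07:09:19Z).  KERNEL: theorems only.
-/
import Literature.NumberTheory.GelbartRogawski1991.DoubledWeilRepresentationUndoublingArch
import HarnessLib

/-!
# The archimedean component of ANY `χ`-normalised doubled Weil representation is Folland's section twisted by `η_t` (by-name bridge)

Namespace `Summit.HodgeConjecture.HodgeConjecture.Cruxes.HLiu418.K2LiuDoubledWeilRepArchPinned`.  KERNEL ONLY: three theorems, no definition,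
no named fact, no `sorry`.

Setting of ★ `GelbartRogawski1991.DoubledUnitaryGlobalSplittingData` (CM field `L`, `L⁺ = Fp L`, real non-zero diagonal hermitian data
`dV`, `dW`, the doubled group `H = U(J^𝔻)`, `HA = H(𝔸_{L⁺})`, `MpD = Mp(𝕎^𝔻)ᶜᵒⁿᵗ`, the prescription `IsDoubledWeilRep χ sD`) — the currency
of the tree's Siegel–Weil sections `K2Lit.swSection sD Φ s` ∕ `K2LiuSiegelWeilSectionContinuous.continuous_swSection`.

For a unitary Hecke character `χ` of `L` with `χ|_{𝕀_{L⁺}} = ε_{L/L⁺}` and of odd unitary archimedean type `(t, 0)`: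

* `sD_archToAdelic_eq_archHalfOf` — for ANY `sD : H(𝔸) →* Mp(𝕎^𝔻)ᶜᵒⁿᵗ` with `IsDoubledWeilRep χ sD` and EVERY `g ∈ H(L⁺ ⊗ ℝ)`:
  `sD (g, 1_f) = archHalfOf t g`, where ★ `archHalfOf t = archWeilHalfD ⊗ η_t` is Folland's `det^{1/2}`-section of the doubled group
  (★ `sectionD`, lifted to `Mp(𝕎^𝔻)ᶜᵒⁿᵗ`) twisted by the EXPLICIT continuous character ★ `etaD t = ∏_v det(g_{w(v)})^{(t_{w(v)}+1)/2}`
  (two lines: ★ `isDoubledWeilRep_unique` against ★ `doubledWeilRep χ`, then ★ `doubledWeilRep_archToAdelic_eq_archHalfOf`);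
  `comp_archToAdelic_eq_archHalfOf` — the same as an identity of homomorphisms `H(L⁺ ⊗ ℝ) →* Mp(𝕎^𝔻)ᶜᵒⁿᵗ`;
* `omega_sD_archToAdelic_tmul` — the operator form on pure tensors `a ⊗ f` (`a` archimedean Schwartz, `f` finite Schwartz–Bruhat):
  `ω(sD (k, 1_f))(a ⊗ f) = η_t(k) • ((frameD^* sectionD(k) frameD_*) a ⊗ f)` (★ `omega_archHalfOf_tmul`).

So the scalar `ψ` in «`ω(sD(k,1)) = ψ(k) · (Folland's operator ⊗ 1)`» is `ψ = η_t`, an integer power of the place determinants — NOT `1`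
in general (★ `coe_etaD_archKPlace`: `η_t(k_{v₀,u}) = ((det u)^M)^{(t_{w(v₀)}+1)/2}`; `ψ ≡ 1` iff `t_w = −1` at every `w`): Folland's section
is `det^{1/2}`-normalised, the `χ`-normalisation on `P_Δ(L⁺ ⊗ ℝ)` is reached exactly by the twist (★ `etaD_sq_mul_prod_inv_eq_chiDet`).

HONEST SCOPE.  By-name assembly of tree theorems; nothing of [Liu2021] is asserted; HC_CM is NOT proved here or anywhere in the tree.

References: [GelbartRogawski1991] S. Gelbart, J. Rogawski, Invent. Math. 105 (1991), §3.1 Prop. 3.1.1 p. 455; [Kudla1994] S. Kudla,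
Israel J. Math. 87 (1994), §3 Thm. 3.1; [Paul1998] A. Paul, J. Funct. Anal. 159 (1998), §1.2 (1.2.1)–(1.2.2) p. 389; [Weil1964] A. Weil,
Acta Math. 111 (1964), Chap. III n° 38 p. 189.
-/

set_option autoImplicit false
set_option linter.dupNamespace false -- the mandated namespace repeats `HodgeConjecture.HodgeConjecture`

noncomputable section

open scoped Classical
open scoped Matrix Kronecker TensorProduct SchwartzMap
open NumberField NumberField.InfinitePlace NumberField.mixedEmbedding IsDedekindDomain
open Literature.RepresentationTheory.HeisenbergGroup
open Literature.NumberTheory.Automorphic Literature.NumberTheory.Automorphic.UnitaryGroup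
open Literature.NumberTheory.Weil1964
open Literature.RepresentationTheory.HarrisKudlaSweet1996
open Literature.NumberTheory.GaloisRepresentations
open Literature.NumberTheory.GelbartRogawski1991 Literature.NumberTheory.GelbartRogawski1991.UnitaryDualPair
open Literature.NumberTheory.GelbartRogawski1991.UnitaryDualPair.LocalSplitting
open Literature.NumberTheory.GelbartRogawski1991.GRConstruction
open Literature.NumberTheory.Automorphic.Liu2021.Def411WeilCarriersDoubling (doubledWeilRep isDoubledWeilRep_doubledWeilRep)

namespace Summit.HodgeConjecture.HodgeConjecture.Cruxes.HLiu418.K2LiuDoubledWeilRepArchPinned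

variable (L : Type) [Field L] [NumberField L] [IsCMField L]

variable {N M n : ℕ} (e : Fin N × Fin M ≃ Fin n)
  (dV : Fin N → L) (hdV : ∀ i, IsCMField.complexConj L (dV i) = dV i) (hdV0 : ∀ i, dV i ≠ 0)
  (dW : Fin M → L) (hdW : ∀ i, IsCMField.complexConj L (dW i) = dW i) (hdW0 : ∀ i, dW i ≠ 0)

/-- **THE ARCHIMEDEAN COMPONENT OF ANY `χ`-NORMALISED DOUBLED WEIL REPRESENTATION, EXPLICITLY**: for `χ` unitary with `χ|_{𝕀_{L⁺}} = ε` of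
odd unitary archimedean type `(t, 0)`, ANY `sD` with `IsDoubledWeilRep χ sD` and EVERY `g ∈ H(L⁺ ⊗ ℝ)`: `sD (g, 1_f) = (archWeilHalf^𝔻 ⊗ η_t) g`
(★ uniqueness `isDoubledWeilRep_unique` + ★ `doubledWeilRep_archToAdelic_eq_archHalfOf`).
[cite: GelbartRogawski1991, §3.1 Prop. 3.1.1 p. 455 L1–2] [cite: Kudla1994, §3 Thm. 3.1] [cite: Paul1998, §1.2 (1.2.1)–(1.2.2) p. 389] -/
theorem sD_archToAdelic_eq_archHalfOf {χ : HeckeCharacter L} (hχu : χ.IsUnitary) (hχs : IsSplittingChar L 1 χ)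
    {sD : HA L e dV hdV dW hdW →* MpD L e dV hdV dW hdW} (hsD : IsDoubledWeilRep L e dV hdV hdV0 dW hdW hdW0 χ sD)
    {t : InfinitePlace L → ℤ} (ht : χ.HasUnitaryArchType t 0) (hodd : ∀ w, Odd (t w))
    (g : UnitaryGroup.arch (Fp L) L (IsCMField.complexConj L) (n + n) (hermD L e dV hdV dW hdW)) :
    sD (UnitaryGroup.archToAdelic (Fp L) L (IsCMField.complexConj L) (n + n) (hermD L e dV hdV dW hdW) g) =
      archHalfOf L e dV hdV hdV0 dW hdW hdW0 t g := by
  rw [DoubledWeilUniqueness.isDoubledWeilRep_unique L e dV hdV hdV0 dW hdW hdW0 χ hsD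
    (isDoubledWeilRep_doubledWeilRep L e dV hdV hdV0 dW hdW hdW0 χ hχu hχs)]
  exact doubledWeilRep_archToAdelic_eq_archHalfOf L e dV hdV hdV0 dW hdW hdW0 hχu hχs ht hodd g

/-- the same as an identity of homomorphisms: `sD ∘ (g ↦ (g, 1_f)) = archWeilHalf^𝔻 ⊗ η_t` on `H(L⁺ ⊗ ℝ)`.
[cite: GelbartRogawski1991, §3.1 Prop. 3.1.1 p. 455 L1–2] [cite: Kudla1994, §3 Thm. 3.1] -/
theorem comp_archToAdelic_eq_archHalfOf {χ : HeckeCharacter L} (hχu : χ.IsUnitary) (hχs : IsSplittingChar L 1 χ)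
    {sD : HA L e dV hdV dW hdW →* MpD L e dV hdV dW hdW} (hsD : IsDoubledWeilRep L e dV hdV hdV0 dW hdW hdW0 χ sD)
    {t : InfinitePlace L → ℤ} (ht : χ.HasUnitaryArchType t 0) (hodd : ∀ w, Odd (t w)) :
    sD.comp (UnitaryGroup.archToAdelic (Fp L) L (IsCMField.complexConj L) (n + n) (hermD L e dV hdV dW hdW)) =
      archHalfOf L e dV hdV hdV0 dW hdW hdW0 t :=
  MonoidHom.ext fun g => sD_archToAdelic_eq_archHalfOf L e dV hdV hdV0 dW hdW hdW0 hχu hχs hsD ht hodd g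

/-- **THE OPERATOR FORM ON PURE TENSORS**: for `χ`, `sD`, `t` as above, `k ∈ H(L⁺ ⊗ ℝ)`, an archimedean Schwartz function `a` and a finite
Schwartz–Bruhat function `f`: `ω(sD (k, 1_f))(a ⊗ f) = η_t(k) • ((frameD^* sectionD(k) frameD_*) a ⊗ f)` — Folland's operator in the scaled
frame of the doubled diagonal Gram matrix, times the explicit scalar `η_t(k) = ∏_v det(k_{w(v)})^{(t_{w(v)}+1)/2}` (★ `omega_archHalfOf_tmul`).
[cite: GelbartRogawski1991, §3.1 Prop. 3.1.1 p. 455] [cite: Weil1964, Chap. III n° 38 p. 189] [cite: Paul1998, §1.2 (1.2.1)–(1.2.2) p. 389] -/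
theorem omega_sD_archToAdelic_tmul {χ : HeckeCharacter L} (hχu : χ.IsUnitary) (hχs : IsSplittingChar L 1 χ)
    {sD : HA L e dV hdV dW hdW →* MpD L e dV hdV dW hdW} (hsD : IsDoubledWeilRep L e dV hdV hdV0 dW hdW hdW0 χ sD)
    {t : InfinitePlace L → ℤ} (ht : χ.HasUnitaryArchType t 0) (hodd : ∀ w, Odd (t w))
    (k : UnitaryGroup.arch (Fp L) L (IsCMField.complexConj L) (n + n) (hermD L e dV hdV dW hdW))
    (a : 𝓢((Fin (n + n) → mixedSpace (Fp L)), ℂ)) (f : FinSB (Fp L) (Fin (n + n))) :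
    adelicMpCont.omega (Fp L) (Fin (n + n)) (gramDA L e dV hdV dW hdW)
        (sD (UnitaryGroup.archToAdelic (Fp L) L (IsCMField.complexConj L) (n + n) (hermD L e dV hdV dW hdW) k))
        (piSchwartzBruhatEquiv (Fp L) (Fin (n + n)) (a ⊗ₜ f)) =
      (((etaD L e dV hdV dW hdW t k : ℂˣ) : ℂ)) • piSchwartzBruhatEquiv (Fp L) (Fin (n + n))
        (carrierConjEquiv
            (scaledFrame (Fp L) (Fin (n + n))
              (placeScale (n + n) fun v => sqrtAbs (signVec (cmPlaceOver L)
                (fun k => Sum.elim (cmGramEntry L e dV hdV dW hdW) (-cmGramEntry L e dV hdV dW hdW) ((LocalSplitting.e₂ n).symm k))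
                (imagUnit L) v))
              (placeScale_ne_zero (n + n) (sqrtAbs_signVec_ne_zero (IsCMField.complexConj_ne_one L) (cmPlaceOver_smul L)
                (complexConj_imagUnit L) (imagUnit_ne_zero L) (gramD_gram_realDiagonal_entry_ne_zero L e dV hdV dW hdW hdV0 hdW0))))
            (archWeilSectionS L (IsCMField.complexConj L) (n + n) (IsCMField.complexConj_ne_one L) (cmPlaceOver L) (cmPlaceOver_smul L)
              (cmPlaceOver_comap L) _ (gramD_gram_realDiagonal_entry_ne_zero L e dV hdV dW hdW hdV0 hdW0)
              (gramD_eq_diagonal_cm L e dV hdV dW hdW) (J := hermD L e dV hdV dW hdW) rfl (complexConj_imagUnit L) (imagUnit_ne_zero L)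
              k).1.2 a ⊗ₜ f) := by
  exact (congrArg (fun q : MpD L e dV hdV dW hdW => adelicMpCont.omega (Fp L) (Fin (n + n)) (gramDA L e dV hdV dW hdW) q
      (piSchwartzBruhatEquiv (Fp L) (Fin (n + n)) (a ⊗ₜ f)))
    (sD_archToAdelic_eq_archHalfOf L e dV hdV hdV0 dW hdW hdW0 hχu hχs hsD ht hodd k)).trans
    (omega_archHalfOf_tmul L e dV hdV hdV0 dW hdW hdW0 t k a f)

end Summit.HodgeConjecture.HodgeConjecture.Cruxes.HLiu418.K2LiuDoubledWeilRepArchPinned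

end
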